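import Summits.Ventures.PercRepro.RankLevelSetLevelSixT22Free8Partial
import Summits.Ventures.PercRepro.RankLevelSetLevelSixArithSq21F8Sh7
import Summits.Ventures.PercRepro.RankLevelSetLevelSixArithTwoSq20N8Sh8
import Summits.Ventures.PercRepro.RankLevelSetLevelSixArithTriTriSq20N8Sh8
import Summits.Ventures.PercRepro.S2CoreSeventeenSplit

/-!
# PercRepro — THE CORE CELL `(22, 8)` MODULO THE BRANCHES `s₃ ≥ 7` (p8 g12, S3)

`proofs/P8-G12-LEVER22.md` §7. The coloop case of `(22, 8)`: `M ∖ e` of rank `21` is coloop-free — the existing cell at shift `7`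
(`c025_core_six_t22_scaled1_cf8`, ratio `0.965`, no lever) — or has a coloop `e'`, and the 2-times scaled every-core terminal on
`M ∖ e ∖ e'` of rank `20` splits on the number of triangles: `≤ 2` (the existing cell, `0.940`), `3 … 6` (THE THREE-TRIANGLE CELL,
`0.996`), `≥ 7` OPEN (form (ii)). Hence `c025_core_six_twentytwo_8_of`: `RLS M 22 6` on every `e`-free core of rank `22`, corank `8`,
given the two `s₃ ≥ 7` branches (the coloop-free cell at rank `22`; the 2-times scaled statement at rank `20`). Axioms: standard.
-/

open scoped Matroid

namespace PercRepro

namespace ThmN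

open Set

variable {α : Type}

set_option maxHeartbeats 1600000 in
/-- **The 1-times scaled coloop-free cell `(21, 8)`** (the existing cell `sq27di2v`, `phiK 22 6 / 2`, `D = C(28, 6)`). -/
theorem c025_core_six_t22_scaled1_cf8 (M : Matroid α) [M.Finite] (hcf : ∀ e ∈ M.E, ¬ M.IsColoop e)
    (hR : M.eRank = (21 : ℕ∞)) (hn : M.E.ncard = 21 + 8)
    (hfree : ∀ e ∈ M.E, ∃ A ⊆ M.E \ {e}, e ∉ M.closure A ∧ e ∉ M.closure ((M.E \ {e}) \ A)) :
    phiK (21 + 1) 6 / 2 * (Matroid.topCount M 21 6 : ℚ) ≤ (Matroid.midCount M 21 6 : ℚ) := by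
  classical
  have hR' : M.eRank = ((21 : ℕ) : ℕ∞) := hR
  have hd : M.E.encard = M.eRank + (8 : ℕ) := by
    rw [hR, ← M.ground_finite.cast_ncard_eq, hn]
    push_cast
    ring
  have hc : ∀ X ⊆ M.E, M.eRk X ≤ ((6 - 2 : ℕ) : ℕ∞) → (X.ncard : ℕ∞) ≤ M.eRk X + cnull 4 :=
    fun X hX hr => nullity_cap_core M hfree 4 (le_refl 4) X hX (by simpa using hr)
  have hc6 : cnull 4 + 1 ≤ 7 := by simp [cnull]
  have hcj : ∀ X ⊆ M.E, M.eRk X ≤ ((6 - 2 - 1 : ℕ) : ℕ∞) → (X.ncard : ℕ∞) ≤ M.eRk X + cnull (3) :=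
    fun X hX hr => nullity_cap_core M hfree 3 (by omega) X hX
      (by rwa [show (6 - 2 - 1 : ℕ) = 3 by omega] at hr)
  have hcj' : ∀ X ⊆ M.E, M.eRk X ≤ ((6 - 1 - 1 - 1 : ℕ) : ℕ∞) → (X.ncard : ℕ∞) ≤ M.eRk X + cnull (3) :=
    fun X hX hr => nullity_cap_core M hfree 3 (by omega) X hX
      (by rwa [show (6 - 1 - 1 - 1 : ℕ) = 3 by omega] at hr)
  have hUG : (Matroid.UG M 6 7).ncard ≤ 13 := by
    have := Matroid.ncard_UG_le_cf (M := M) (q := 6) (ν₁ := 7) (j := 2) (by norm_num) hcf hR' hn (by omega) hc hc6 hcj (by norm_num [cnull])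
    simpa using this
  have hUH : (Matroid.UH M 6 7).ncard ≤ 12 := by
    have := Matroid.ncard_UH_le_cf (M := M) (q := 6) (ν₁ := 7) (j' := 1) (by norm_num) hcf hR' hn (by omega) hc hc6 hcj' (by norm_num [cnull])
    simpa using this
  have hΦ : phiK (21 + 1) 6 / 2 ≤ (2 : ℚ) ^ (21 + 6) / (((21 + 7).choose 6 : ℕ) : ℚ) := by
    have := phiK_succ_div_two_le 21 6
    rwa [show 21 + 1 + 6 = 21 + 7 by norm_num] at this
  exact c025_core_six_heavy_cell_sq27di2v M 21 8 7 13 12 0 10000 400 14 435 62 11 1165 2262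
      ((21 + 7).choose 6) (Nat.choose_pos (by omega)) (phiK (21 + 1) 6 / 2) hΦ (by norm_num) (by omega)
      (by norm_num) hUG hUH (by omega) (Or.inl (by norm_num)) (by norm_num) (by norm_num) (by norm_num)
      ((ncard_triangles_le_cq3_pred_of_coloopFree M hfree hcf hR' hn (by omega) (by omega) (by omega)).trans (by decide))
      ((S1.ncard_fourCircuits_le_gb14 8 M hfree hd 29 (by rw [coloops_eq_empty_of_forall M hcf, Set.sdiff_empty, hn])).trans (by decide))
      (s5_cf_of M hfree hcf (d := 7) (by rw [hd]; norm_num) 29 360 435 (by norm_num) (by omega) (by decide) (by omega))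
      (s6_cf_of M hfree hcf (d := 7) (by rw [hd]; norm_num) 29 924 1165 (by norm_num) (by omega) (by decide) (by omega))
      (s7_cf_of M hfree hcf (d := 7) (by rw [hd]; norm_num) 29 1716 2262 (by norm_num) (by omega) (by decide) (by omega))
      (Or.inl tail_six_sq21F8_sh7) hR' hn hfree level_six_poly_sq21F8_sh7

set_option maxHeartbeats 1600000 in
/-- **The 2-times scaled every-core terminal `(20, 8)` with at most two triangles** (the existing cell; `phiK 22 6 / 4`). -/
theorem c025_core_six_t22_scaled2_every8_two (M : Matroid α) [M.Finite]
    (hR : M.eRank = (20 : ℕ∞)) (hn : M.E.ncard = 20 + 8)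
    (hfree : ∀ e ∈ M.E, ∃ A ⊆ M.E \ {e}, e ∉ M.closure A ∧ e ∉ M.closure ((M.E \ {e}) \ A))
    (hs3 : {C : Set α | M.IsCircuit C ∧ C.ncard = 3}.ncard ≤ 2) :
    phiK (20 + 2) 6 / 4 * (Matroid.topCount M 20 6 : ℚ) ≤ (Matroid.midCount M 20 6 : ℚ) := by
  classical
  have hR' : M.eRank = ((20 : ℕ) : ℕ∞) := hR
  have hd : M.E.encard = M.eRank + (8 : ℕ) := by
    rw [hR, ← M.ground_finite.cast_ncard_eq, hn]
    push_cast
    ring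
  have hc : ∀ X ⊆ M.E, M.eRk X ≤ ((6 - 2 : ℕ) : ℕ∞) → (X.ncard : ℕ∞) ≤ M.eRk X + cnull 4 :=
    fun X hX hr => nullity_cap_core M hfree 4 (le_refl 4) X hX (by simpa using hr)
  have hc6 : cnull 4 + 1 ≤ 7 := by simp [cnull]
  have hcj : ∀ X ⊆ M.E, M.eRk X ≤ ((6 - 2 - 1 : ℕ) : ℕ∞) → (X.ncard : ℕ∞) ≤ M.eRk X + cnull (3) :=
    fun X hX hr => nullity_cap_core M hfree 3 (by omega) X hX
      (by rwa [show (6 - 2 - 1 : ℕ) = 3 by omega] at hr)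
  have hcj' : ∀ X ⊆ M.E, M.eRk X ≤ ((6 - 1 - 1 - 1 : ℕ) : ℕ∞) → (X.ncard : ℕ∞) ≤ M.eRk X + cnull (3) :=
    fun X hX hr => nullity_cap_core M hfree 3 (by omega) X hX
      (by rwa [show (6 - 1 - 1 - 1 : ℕ) = 3 by omega] at hr)
  have hUG : (Matroid.UG M 6 7).ncard ≤ 16 := by
    have := Matroid.ncard_UG_le (M := M) (q := 6) (ν₁ := 7) (j := 2) (by norm_num) hd hc hc6 hcj (by norm_num [cnull])
    simpa using this
  have hUH : (Matroid.UH M 6 7).ncard ≤ 14 := by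
    have := Matroid.ncard_UH_le (M := M) (q := 6) (ν₁ := 7) (j' := 1) (by norm_num) hd hc hc6 hcj' (by norm_num [cnull])
    simpa using this
  have hΦ : phiK (20 + 2) 6 / 4 ≤ (2 : ℚ) ^ (20 + 6) / (((20 + 8).choose 6 : ℕ) : ℚ) := by
    have h := phiK_le_two_pow_div_six (20 + 2)
    rw [show 20 + 2 + 6 = 20 + 8 by norm_num] at h
    have h4 : (2 : ℚ) ^ (20 + 8) = 2 ^ (20 + 6) * 4 := by norm_num
    rw [h4] at h
    have h5 := div_le_div_of_nonneg_right h (by norm_num : (0 : ℚ) ≤ 4)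
    exact h5.trans (le_of_eq (by ring))
  exact c025_core_six_heavy_cell_sq27di2v M 20 8 7 16 14 0 10000 700 14 585 88 2 1716 3432
      ((20 + 8).choose 6) (Nat.choose_pos (by omega)) (phiK (20 + 2) 6 / 4) hΦ (by norm_num) (by omega)
      (by norm_num) hUG hUH (by omega) (Or.inl (by norm_num)) (by norm_num) (by norm_num) (by norm_num)
      hs3
      ((ncard_fourCircuits_le_avgChain14 8 M hfree hd).trans (by decide))
      ((S1.ncard_fiveCircuits_le_avgChain5c 8 M hfree hd).trans (by decide))
      ((Matroid.ncard_circuits_le_choose_of_encard M hd 5).trans (by decide))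
      ((Matroid.ncard_circuits_le_choose_of_encard M hd 6).trans (by decide))
      (Or.inl tail_six_two_sq20N8_sh8) hR' hn hfree level_six_poly_two_sq20N8_sh8

set_option maxHeartbeats 1600000 in
/-- **The 2-times scaled every-core terminal `(20, 8)` with three to six triangles** (THE THREE-TRIANGLE CELL). -/
theorem c025_core_six_t22_scaled2_every8_tritri (M : Matroid α) [M.Finite]
    (hR : M.eRank = (20 : ℕ∞)) (hn : M.E.ncard = 20 + 8)
    (hfree : ∀ e ∈ M.E, ∃ A ⊆ M.E \ {e}, e ∉ M.closure A ∧ e ∉ M.closure ((M.E \ {e}) \ A))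
    (hs3 : {C : Set α | M.IsCircuit C ∧ C.ncard = 3}.ncard ≤ 6)
    (hthree : ∃ C₁ C₂ C₃ : Set α, M.IsCircuit C₁ ∧ M.IsCircuit C₂ ∧ M.IsCircuit C₃ ∧ C₁.ncard = 3 ∧ C₂.ncard = 3 ∧
      C₃.ncard = 3 ∧ C₁ ≠ C₂ ∧ C₁ ≠ C₃ ∧ C₂ ≠ C₃) :
    phiK (20 + 2) 6 / 4 * (Matroid.topCount M 20 6 : ℚ) ≤ (Matroid.midCount M 20 6 : ℚ) := by
  classical
  have hR' : M.eRank = ((20 : ℕ) : ℕ∞) := hR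
  have hd : M.E.encard = M.eRank + (8 : ℕ) := by
    rw [hR, ← M.ground_finite.cast_ncard_eq, hn]
    push_cast
    ring
  have hc : ∀ X ⊆ M.E, M.eRk X ≤ ((6 - 2 : ℕ) : ℕ∞) → (X.ncard : ℕ∞) ≤ M.eRk X + cnull 4 :=
    fun X hX hr => nullity_cap_core M hfree 4 (le_refl 4) X hX (by simpa using hr)
  have hc6 : cnull 4 + 1 ≤ 7 := by simp [cnull]
  have hcj : ∀ X ⊆ M.E, M.eRk X ≤ ((6 - 2 - 1 : ℕ) : ℕ∞) → (X.ncard : ℕ∞) ≤ M.eRk X + cnull (3) :=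
    fun X hX hr => nullity_cap_core M hfree 3 (by omega) X hX
      (by rwa [show (6 - 2 - 1 : ℕ) = 3 by omega] at hr)
  have hcj' : ∀ X ⊆ M.E, M.eRk X ≤ ((6 - 1 - 1 - 1 : ℕ) : ℕ∞) → (X.ncard : ℕ∞) ≤ M.eRk X + cnull (3) :=
    fun X hX hr => nullity_cap_core M hfree 3 (by omega) X hX
      (by rwa [show (6 - 1 - 1 - 1 : ℕ) = 3 by omega] at hr)
  have hUG : (Matroid.UG M 6 7).ncard ≤ 16 := by
    have := Matroid.ncard_UG_le (M := M) (q := 6) (ν₁ := 7) (j := 2) (by norm_num) hd hc hc6 hcj (by norm_num [cnull])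
    simpa using this
  have hUH : (Matroid.UH M 6 7).ncard ≤ 14 := by
    have := Matroid.ncard_UH_le (M := M) (q := 6) (ν₁ := 7) (j' := 1) (by norm_num) hd hc hc6 hcj' (by norm_num [cnull])
    simpa using this
  have hΦ : phiK (20 + 2) 6 / 4 ≤ (2 : ℚ) ^ (20 + 6) / (((20 + 8).choose 6 : ℕ) : ℚ) := by
    have h := phiK_le_two_pow_div_six (20 + 2)
    rw [show 20 + 2 + 6 = 20 + 8 by norm_num] at h
    have h4 : (2 : ℚ) ^ (20 + 8) = 2 ^ (20 + 6) * 4 := by norm_num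
    rw [h4] at h
    have h5 := div_le_div_of_nonneg_right h (by norm_num : (0 : ℚ) ≤ 4)
    exact h5.trans (le_of_eq (by ring))
  exact c025_core_six_heavy_cell_sq27di2v_tritri M 20 8 7 16 14 0 10000 600 14 585 88 6 1716 3432
      ((20 + 8).choose 6) (Nat.choose_pos (by omega)) (phiK (20 + 2) 6 / 4) hΦ (by norm_num) (by omega)
      (by norm_num) hUG hUH (by omega) (Or.inl (by norm_num)) (by norm_num) (by norm_num) (by norm_num)
      hs3
      ((ncard_fourCircuits_le_avgChain14 8 M hfree hd).trans (by decide))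
      ((S1.ncard_fiveCircuits_le_avgChain5c 8 M hfree hd).trans (by decide))
      ((Matroid.ncard_circuits_le_choose_of_encard M hd 5).trans (by decide))
      ((Matroid.ncard_circuits_le_choose_of_encard M hd 6).trans (by decide))
      (Or.inl tail_six_tritri_sq20N8_sh8) hR' hn hfree (by omega) hthree level_six_poly_tritri_sq20N8_sh8

/-- **The 2-times scaled every-core terminal `(20, 8)` modulo the branch `s₃ ≥ 7`.** -/
theorem c025_core_six_t22_scaled2_every8_of_seven (M : Matroid α) [M.Finite]
    (hR : M.eRank = (20 : ℕ∞)) (hn : M.E.ncard = 20 + 8)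
    (hfree : ∀ e ∈ M.E, ∃ A ⊆ M.E \ {e}, e ∉ M.closure A ∧ e ∉ M.closure ((M.E \ {e}) \ A))
    (h7 : 7 ≤ {C : Set α | M.IsCircuit C ∧ C.ncard = 3}.ncard →
      phiK (20 + 2) 6 / 4 * (Matroid.topCount M 20 6 : ℚ) ≤ (Matroid.midCount M 20 6 : ℚ)) :
    phiK (20 + 2) 6 / 4 * (Matroid.topCount M 20 6 : ℚ) ≤ (Matroid.midCount M 20 6 : ℚ) := by
  classical
  have hfin : {C : Set α | M.IsCircuit C ∧ C.ncard = 3}.Finite :=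
    M.ground_finite.finite_subsets.subset (fun C hC => hC.1.subset_ground)
  by_cases hbig : 7 ≤ {C : Set α | M.IsCircuit C ∧ C.ncard = 3}.ncard
  · exact h7 hbig
  by_cases h : 2 < {C : Set α | M.IsCircuit C ∧ C.ncard = 3}.ncard
  · obtain ⟨C₁, C₂, C₃, hC₁, hC₂, hC₃, h12, h13, h23⟩ := (Set.two_lt_ncard_iff hfin).1 h
    exact c025_core_six_t22_scaled2_every8_tritri M hR hn hfree (by omega)
      ⟨C₁, C₂, C₃, hC₁.1, hC₂.1, hC₃.1, hC₁.2, hC₂.2, hC₃.2, h12, h13, h23⟩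
  · exact c025_core_six_t22_scaled2_every8_two M hR hn hfree (by omega)

/-- **The 1-times scaled cell on every `e`-free core of rank `21`, corank `8`, modulo the terminal's branch `s₃ ≥ 7`.** -/
theorem c025_core_six_t22_scaled1_all8_of (M : Matroid α) [M.Finite]
    (hR : M.eRank = (21 : ℕ∞)) (hn : M.E.ncard = 21 + 8)
    (hfree : ∀ e ∈ M.E, ∃ A ⊆ M.E \ {e}, e ∉ M.closure A ∧ e ∉ M.closure ((M.E \ {e}) \ A))
    (hev7 : ∀ (N : Matroid α) [N.Finite], N.eRank = (20 : ℕ∞) → N.E.ncard = 20 + 8 →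
      (∀ e ∈ N.E, ∃ A ⊆ N.E \ {e}, e ∉ N.closure A ∧ e ∉ N.closure ((N.E \ {e}) \ A)) →
      7 ≤ {C : Set α | N.IsCircuit C ∧ C.ncard = 3}.ncard →
      phiK (20 + 2) 6 / 4 * (Matroid.topCount N 20 6 : ℚ) ≤ (Matroid.midCount N 20 6 : ℚ)) :
    phiK (21 + 1) 6 / 2 * (Matroid.topCount M 21 6 : ℚ) ≤ (Matroid.midCount M 21 6 : ℚ) := by
  by_cases hc : ∃ e ∈ M.E, M.IsColoop e
  · obtain ⟨e, _, hce⟩ := hc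
    have hR' : M.eRank = ((20 + 1 : ℕ) : ℕ∞) := by rw [hR]; norm_num
    obtain ⟨hn20, hR20, hfree20, -⟩ := delete_core_data M hce hR' (by omega) hfree
    have h := c025_core_six_t22_scaled2_every8_of_seven (M ＼ {e}) hR20 hn20 hfree20
      (hev7 (M ＼ {e}) hR20 hn20 hfree20)
    have h' : phiK (21 + 1) 6 / 2 / 2 * (Matroid.topCount (M ＼ {e}) 20 6 : ℚ) ≤
        (Matroid.midCount (M ＼ {e}) 20 6 : ℚ) := by
      have e1 : phiK (21 + 1) 6 / 2 / 2 = phiK (20 + 2) 6 / 4 := by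
        rw [show (21 + 1 : ℕ) = 20 + 2 by norm_num]; ring
      rw [e1]; exact h
    exact weighted_of_isColoop_scaled M hce (by norm_num) hR' (phiK (21 + 1) 6 / 2) h'
  · exact c025_core_six_t22_scaled1_cf8 M (fun e he hce => hc ⟨e, he, hce⟩) hR hn hfree

/-- **THE CORE CELL `(22, 8)` MODULO THE TWO BRANCHES `s₃ ≥ 7`** (the coloop-free cell at rank `22`; the 2-times scaled
every-core terminal at rank `20`). -/
theorem c025_core_six_twentytwo_8_of (M : Matroid α) [M.Finite]
    (hR : M.eRank = (22 : ℕ∞)) (hn : M.E.ncard = 22 + 8)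
    (hfree : ∀ e ∈ M.E, ∃ A ⊆ M.E \ {e}, e ∉ M.closure A ∧ e ∉ M.closure ((M.E \ {e}) \ A))
    (hcf7 : (∀ e ∈ M.E, ¬ M.IsColoop e) → 7 ≤ {C : Set α | M.IsCircuit C ∧ C.ncard = 3}.ncard → RLS M 22 6)
    (hev7 : ∀ (N : Matroid α) [N.Finite], N.eRank = (20 : ℕ∞) → N.E.ncard = 20 + 8 →
      (∀ e ∈ N.E, ∃ A ⊆ N.E \ {e}, e ∉ N.closure A ∧ e ∉ N.closure ((N.E \ {e}) \ A)) →
      7 ≤ {C : Set α | N.IsCircuit C ∧ C.ncard = 3}.ncard →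
      phiK (20 + 2) 6 / 4 * (Matroid.topCount N 20 6 : ℚ) ≤ (Matroid.midCount N 20 6 : ℚ)) :
    RLS M 22 6 := by
  by_cases hc : ∃ e ∈ M.E, M.IsColoop e
  · obtain ⟨e, _, hce⟩ := hc
    have hR' : M.eRank = ((21 + 1 : ℕ) : ℕ∞) := by rw [hR]; norm_num
    obtain ⟨hn21, hR21, hfree21, -⟩ := delete_core_data M hce hR' (by omega) hfree
    exact RLS_of_coloop_scaled M hce (by norm_num) hR'
      (c025_core_six_t22_scaled1_all8_of (M ＼ {e}) hR21 hn21 hfree21 hev7)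
  · have hcf : ∀ e ∈ M.E, ¬ M.IsColoop e := fun e he hce => hc ⟨e, he, hce⟩
    exact c025_core_six_t22_free8_of_seven M hcf hR hn hfree (hcf7 hcf)

end ThmN

end PercRepro
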